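import Summits.AtomisticToContinuum.HydrodynamicLimit.Theorems.JParityClosureOddContactSymmetryGibbsInvariance
import Summits.AtomisticToContinuum.HydrodynamicLimit.Theorems.BandCoherenceLDAlongFamilies.Negative.Gauss
import Literature.MathematicalPhysics.KineticTheory.HardSphereWindowPressureStatic
import Literature.MathematicalPhysics.KineticTheory.HardSphereUniformGas
import Literature.MathematicalPhysics.KineticTheory.HardSphereDisplacementPathLength
import HarnessLib

/-!
# Band-coherence drift witness, III: velocity marginal, boost density and static window means of the homogeneous Gibbs law

Negative knowledge for the crux `OneFlightGossipEngine.BandCoherenceLDAlongFamilies` (stmt-AtomisticToContinuum-17700):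
the GALILEAN-DRIFT WITNESS of refuter-rattack-stmt-AtomisticToContinuum-17700-0 (item evidence WITNESS.md).  The tested
band-coherence functional `S = Σᵢ 1{η cubᵢ < ‖q̄ᵢ‖} cubBandᵢ` has a non-zero LINEAR response to a uniform boost `D e₀` of
the homogeneous reference law, whose relative-entropy cost `(N+1)D²/2` is QUADRATIC, while the statement demands the
exponential moment at the FIXED tilt `(8Θ̄K₁)⁻¹` to be `≤ e^{ε(N+1)}` for every `ε > 0`.  No Theses declaration is asserted
positively in this file (pure helper theorems, no definitions).

This file: §4 under the homogeneous Gibbs law `G = localGibbsLaw σ a u θ N Φ` (constant profiles, `σ ≤ 1/2`) the velocity of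
each particle is `N(u, θ id)` (`map_vel_localGibbsLaw`, from the rung-0 product structure `localGibbsMeasure_rung0_eq_map`);
§5 the zero-drift law has density `exp(−ℓ_D)`, `ℓ_D = Σᵢ (D vᵢ₀ − D²/2)`, with respect to the boosted one
(`localGibbsLaw_zero_eq_withDensity`: same configurational partition function); §6 window means of bounded (Bochner/Fubini)
and nonnegative (Tonelli) one-body observables along ANY hard-sphere flow are STATIC under `G`
(`integral_windowAvg_eq`, `lintegral_window_eq`, `integrable_windowCube`), by joint measurability of the flow on the good
set (`HardSphereFlow.aemeasurable_comp_flow_prod_torus`) and invariance (`measurePreserving_flow_localGibbsLaw_const`: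
Liouville + conservation of energy and momentum).

References: H. Spohn (1991) Part I §2.3 (equilibrium measures are invariant); GST 2013 Prop. 4.1.1.
-/

noncomputable section

open MeasureTheory ProbabilityTheory Set Filter Topology
open scoped ENNReal InnerProductSpace BigOperators

namespace Summit.AtomisticToContinuum.HydrodynamicLimit.Theorems

namespace BandCoherenceLDNegative

open Literature.MathematicalPhysics.KineticTheory Literature.Analysis.FluidPDE

/-! ## §4 The one-particle velocity marginal of the homogeneous Gibbs law -/

section Marginal

variable {σ a θ : ℝ}

/-- **Velocity marginal**: under the homogeneous Gibbs law (constant profiles, `σ ≤ 1/2`) the velocity of particle `i` is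
`N(u, θ id)`-distributed. [folklore] -/
theorem map_vel_localGibbsLaw (ha : 0 < a) (hθ : 0 < θ) (u : V3) (hσ2 : σ ≤ 1 / 2) (N : ℕ)
    (Φ : HardSphereFlow (Torus.geometry (Fin 3)) (hsDiameter σ N) (N + 1)) (i : Fin (N + 1)) :
    (localGibbsLaw σ (fun _ => a) (fun _ => u) (fun _ => θ) N Φ).map (fun z => (z i).2) = gaussMeasure u θ := by
  haveI := isProbabilityMeasure_posGibbsMeasure (a₀ := fun _ : T3 => a) continuous_const (fun _ => ha) hσ2 N
  rw [localGibbsLaw_eq, localGibbsMeasure_rung0_eq_map σ ha.le hθ u N,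
    Measure.map_map (measurable_pi_apply i).snd measurable_zipConfig]
  have hcomp : (fun z : Config (N + 1) (Fin 3) T3 => (z i).2) ∘ zipConfig =
      (Function.eval i) ∘ (Prod.snd : (Fin (N + 1) → T3) × (Fin (N + 1) → V3) → (Fin (N + 1) → V3)) := by
    funext p
    simp [zipConfig_apply]
  rw [hcomp, ← Measure.map_map (measurable_pi_apply i) measurable_snd, Measure.map_snd_prod, measure_univ, one_smul]
  exact (measurePreserving_eval (fun _ : Fin (N + 1) => gaussMeasure u θ) i).map_eq

/-- One-body velocity observables integrate against `N(u, θ id)` under the homogeneous Gibbs law. [folklore] -/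
theorem integral_vel_localGibbsLaw {E : Type*} [NormedAddCommGroup E] [NormedSpace ℝ E] (ha : 0 < a) (hθ : 0 < θ)
    (u : V3) (hσ2 : σ ≤ 1 / 2) (N : ℕ) (Φ : HardSphereFlow (Torus.geometry (Fin 3)) (hsDiameter σ N) (N + 1))
    (i : Fin (N + 1)) {g : V3 → E} (hg : AEStronglyMeasurable g (gaussMeasure u θ)) :
    ∫ z, g (z i).2 ∂(localGibbsLaw σ (fun _ => a) (fun _ => u) (fun _ => θ) N Φ) = ∫ v, g v ∂gaussMeasure u θ := by
  rw [← map_vel_localGibbsLaw ha hθ u hσ2 N Φ i, integral_map (measurable_pi_apply i).snd.aemeasurable]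
  rwa [map_vel_localGibbsLaw ha hθ u hσ2 N Φ i]

/-- Integrability of one-body velocity observables under the homogeneous Gibbs law is Gaussian integrability. [folklore] -/
theorem integrable_vel_localGibbsLaw_iff (ha : 0 < a) (hθ : 0 < θ) (u : V3) (hσ2 : σ ≤ 1 / 2) (N : ℕ)
    (Φ : HardSphereFlow (Torus.geometry (Fin 3)) (hsDiameter σ N) (N + 1)) (i : Fin (N + 1)) {g : V3 → ℝ}
    (hg : AEStronglyMeasurable g (gaussMeasure u θ)) :
    Integrable (fun z => g (z i).2) (localGibbsLaw σ (fun _ => a) (fun _ => u) (fun _ => θ) N Φ) ↔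
      Integrable g (gaussMeasure u θ) := by
  rw [← map_vel_localGibbsLaw ha hθ u hσ2 N Φ i] at hg ⊢
  rw [integrable_map_measure hg (measurable_pi_apply i).snd.aemeasurable]
  rfl

/-- `lintegral` version of the one-body velocity marginal of the homogeneous Gibbs law. [folklore] -/
theorem lintegral_vel_localGibbsLaw (ha : 0 < a) (hθ : 0 < θ) (u : V3) (hσ2 : σ ≤ 1 / 2) (N : ℕ)
    (Φ : HardSphereFlow (Torus.geometry (Fin 3)) (hsDiameter σ N) (N + 1)) (i : Fin (N + 1)) {g : V3 → ℝ≥0∞}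
    (hg : Measurable g) :
    ∫⁻ z, g (z i).2 ∂(localGibbsLaw σ (fun _ => a) (fun _ => u) (fun _ => θ) N Φ) = ∫⁻ v, g v ∂gaussMeasure u θ := by
  rw [← map_vel_localGibbsLaw ha hθ u hσ2 N Φ i, lintegral_map hg (measurable_pi_apply i).snd]

end Marginal


/-! ## §5 The boost: log-density `ℓ_D` and `G₀ = e^{−ℓ_D} · G_D` -/

section Density

/-- The log-density of the boost by `D e₀`, `ℓ_D(z) = Σᵢ (D vᵢ₀ − D²/2)`, is continuous. [folklore] -/
theorem continuous_ell (D : ℝ) (n : ℕ) :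
    Continuous (fun z : Config n (Fin 3) T3 => ∑ j, (D * (z j).2 0 - D ^ 2 / 2)) := by
  refine continuous_finsetSum _ fun i _ => ?_
  exact (continuous_const.mul ((EuclideanSpace.proj (𝕜 := ℝ) (0 : Fin 3)).continuous.comp
    (continuous_snd.comp (continuous_apply i)))).sub continuous_const

/-- Closed form of the boost log-density. [folklore] -/
theorem ell_eq (D : ℝ) {n : ℕ} (z : Config n (Fin 3) T3) :
    (∑ j, (D * (z j).2 0 - D ^ 2 / 2)) = D * ∑ i, (z i).2 0 - n * (D ^ 2 / 2) := by
  rw [Finset.sum_sub_distrib, Finset.sum_const, Finset.card_univ, Fintype.card_fin, Finset.mul_sum, nsmul_eq_mul]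

/-- Pointwise identity of the homogeneous Gibbs weights: `T₀(z) = T_{De₀}(z) · exp(−ℓ_D(z))`. [folklore] -/
theorem tensorPow_zero_eq_mul (D : ℝ) {n : ℕ} (z : Config n (Fin 3) T3) :
    tensorPow n (localGibbsProfile (fun _ => (1 : ℝ)) (fun _ => (0 : V3)) (fun _ => (1 : ℝ))) z =
      tensorPow n (localGibbsProfile (fun _ => (1 : ℝ)) (fun _ => D • (EuclideanSpace.single (0 : Fin 3) (1 : ℝ) : V3)) (fun _ => (1 : ℝ))) z *
        Real.exp (-(∑ j, (D * (z j).2 0 - D ^ 2 / 2))) := by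
  rw [tensorPow_localGibbsProfile_const, tensorPow_localGibbsProfile_const]
  have hA : ∑ i, ‖(z i).2 - (0 : V3)‖ ^ 2 = ∑ i, ‖(z i).2‖ ^ 2 := by simp
  have hB : ∑ i, ‖(z i).2 - D • (EuclideanSpace.single (0 : Fin 3) (1 : ℝ) : V3)‖ ^ 2 = ∑ i, ‖(z i).2‖ ^ 2 - 2 * D * ∑ i, (z i).2 0 + n * D ^ 2 := by
    have h1 : ∀ i, ‖(z i).2 - D • (EuclideanSpace.single (0 : Fin 3) (1 : ℝ) : V3)‖ ^ 2 = ‖(z i).2‖ ^ 2 - 2 * D * (z i).2 0 + D ^ 2 := fun i => by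
      rw [norm_sub_sq_real, inner_smul_e0_right, norm_smul_e0_sq]; ring
    simp_rw [h1]
    rw [Finset.sum_add_distrib, Finset.sum_sub_distrib, Finset.sum_const, Finset.card_univ, Fintype.card_fin,
      ← Finset.mul_sum, nsmul_eq_mul]
  have key : (-∑ i, ‖(z i).2 - (0 : V3)‖ ^ 2) / (2 * 1) = (-∑ i, ‖(z i).2 - D • (EuclideanSpace.single (0 : Fin 3) (1 : ℝ) : V3)‖ ^ 2) / (2 * 1) + -(∑ j, (D * (z j).2 0 - D ^ 2 / 2)) := by
    rw [hA, hB, ell_eq]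
    ring
  rw [key, Real.exp_add]
  ring

variable {σ : ℝ}

/-- **`G₀ = e^{−ℓ_D} · G_{De₀}`**: the zero-drift homogeneous Gibbs law has density `exp(−ℓ_D)` with respect to the
boosted one (same configurational partition function; Gaussian velocity factors). [folklore] -/
theorem localGibbsLaw_zero_eq_withDensity (σ : ℝ) (N : ℕ)
    (Φ : HardSphereFlow (Torus.geometry (Fin 3)) (hsDiameter σ N) (N + 1)) (D : ℝ) :
    localGibbsLaw σ (fun _ => (1 : ℝ)) (fun _ => (0 : V3)) (fun _ => (1 : ℝ)) N Φ =
      (localGibbsLaw σ (fun _ => (1 : ℝ)) (fun _ => D • (EuclideanSpace.single (0 : Fin 3) (1 : ℝ) : V3)) (fun _ => (1 : ℝ)) N Φ).withDensity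
        (fun z => ENNReal.ofReal (Real.exp (-(∑ j, (D * (z j).2 0 - D ^ 2 / 2))))) := by
  have hmD : Measurable fun z : Config (N + 1) (Fin 3) T3 => ENNReal.ofReal
      (canonicalDensity (Torus.geometry (Fin 3)) (hsDiameter σ N) (N + 1)
        (localGibbsProfile (fun _ => (1 : ℝ)) (fun _ => D • (EuclideanSpace.single (0 : Fin 3) (1 : ℝ) : V3)) (fun _ => (1 : ℝ))) z) :=
    (measurable_canonicalDensity _ _
      (measurable_localGibbsProfile continuous_const continuous_const continuous_const)).ennreal_ofReal
  have hmE : Measurable fun z : Config (N + 1) (Fin 3) T3 => ENNReal.ofReal (Real.exp (-(∑ j, (D * (z j).2 0 - D ^ 2 / 2)))) :=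
    (Real.continuous_exp.comp (continuous_ell D (N + 1)).neg).measurable.ennreal_ofReal
  rw [localGibbsLaw_eq, localGibbsLaw_eq]
  unfold localGibbsMeasure
  rw [← withDensity_mul _ hmD hmE]
  congr 1
  funext z
  simp only [Pi.mul_apply]
  have hZ0 := canonicalPartition_eq_posPartition (a₀ := fun _ : T3 => (1 : ℝ)) (θ₀ := fun _ => (1 : ℝ))
    (u₀ := fun _ => (0 : V3)) continuous_const continuous_const continuous_const (fun _ => zero_le_one)
    (fun _ => one_pos) (hsDiameter σ N) (N + 1)
  have hZD := canonicalPartition_eq_posPartition (a₀ := fun _ : T3 => (1 : ℝ)) (θ₀ := fun _ => (1 : ℝ))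
    (u₀ := fun _ => D • (EuclideanSpace.single (0 : Fin 3) (1 : ℝ) : V3)) continuous_const continuous_const continuous_const (fun _ => zero_le_one)
    (fun _ => one_pos) (hsDiameter σ N) (N + 1)
  simp only [canonicalDensity]
  rw [hZ0, hZD]
  by_cases hz : z ∈ hardSphereDomain (Torus.geometry (Fin 3)) (N + 1) (hsDiameter σ N)
  · rw [indicator_of_mem hz, indicator_of_mem hz, tensorPow_zero_eq_mul D z, ← mul_assoc,
      ENNReal.ofReal_mul]
    exact mul_nonneg (inv_nonneg.2 (posPartition_nonneg (fun _ => zero_le_one) _ _))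
      (tensorPow_nonneg (localGibbsProfile_nonneg (fun _ => zero_le_one) fun _ => zero_le_one) _ _)
  · rw [indicator_of_notMem hz, indicator_of_notMem hz, mul_zero, ENNReal.ofReal_zero, zero_mul]

end Density

/-! ## §6 Window expectations under the homogeneous Gibbs law (Fubini + stationarity) -/

section WindowExpect

variable {σ : ℝ}

/-- **Window means of BOUNDED observables are static** under the homogeneous Gibbs law:
`E[w⁻¹ ∫₀ʷ h(Φ_r z) dr] = E[h]` (Fubini on `G × [0, w]` + invariance of `G` under each `Φ_r`). [folklore] -/
theorem integral_windowAvg_eq (hσ2 : σ ≤ 1 / 2) (u : V3) (N : ℕ)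
    (Φ : HardSphereFlow (Torus.geometry (Fin 3)) (hsDiameter σ N) (N + 1))
    {h : Config (N + 1) (Fin 3) T3 → ℝ} (hhm : Measurable h) {C : ℝ} (hC : ∀ z, |h z| ≤ C) {w : ℝ} (hw : 0 < w) :
    ∫ z, (w⁻¹ * ∫ r in (0 : ℝ)..w, h (Φ.flow r z))
        ∂(localGibbsLaw σ (fun _ => (1 : ℝ)) (fun _ => u) (fun _ => (1 : ℝ)) N Φ) =
      ∫ z, h z ∂(localGibbsLaw σ (fun _ => (1 : ℝ)) (fun _ => u) (fun _ => (1 : ℝ)) N Φ) := by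
  set Q := localGibbsLaw σ (fun _ => (1 : ℝ)) (fun _ => u) (fun _ => (1 : ℝ)) N Φ with hQ
  haveI : IsProbabilityMeasure Q := isProbabilityMeasure_localGibbsLaw continuous_const continuous_const
    continuous_const (fun _ => one_pos) (fun _ => one_pos) hσ2 N Φ
  have hgood : Q Φ.goodᶜ = 0 :=
    (withDensity_absolutelyContinuous _ _ : Q ≪ liouville (Torus.geometry (Fin 3)) (N + 1) (hsDiameter σ N))
      Φ.measure_compl_good
  rw [integral_const_mul]
  simp_rw [intervalIntegral.integral_of_le hw.le]
  have hint : Integrable (Function.uncurry fun (z : Config (N + 1) (Fin 3) T3) (r : ℝ) => h (Φ.flow r z))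
      (Q.prod (volume.restrict (Ioc 0 w))) := by
    refine Integrable.of_bound ?_ C (ae_of_all _ fun p => ?_)
    · exact (Φ.aemeasurable_comp_flow_prod_torus hgood (volume.restrict (Ioc 0 w)) (0 : ℝ) hhm).aestronglyMeasurable
    · rw [Real.norm_eq_abs]
      exact hC _
  rw [integral_integral_swap hint]
  have hstat : ∀ r, (∫ z, h (Φ.flow r z) ∂Q) = ∫ z, h z ∂Q := fun r =>
    integral_comp_flow_localGibbsLaw_const σ 1 1 u N Φ r hhm.aestronglyMeasurable
  have hswap : (∫ r in Ioc 0 w, (∫ z, h (Φ.flow r z) ∂Q)) = ∫ r in Ioc 0 w, (∫ z, h z ∂Q) :=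
    integral_congr_ae (ae_of_all _ fun r => hstat r)
  rw [hswap]
  rw [setIntegral_const, measureReal_def, Real.volume_Ioc, sub_zero, ENNReal.toReal_ofReal hw.le, smul_eq_mul,
    ← mul_assoc, inv_mul_cancel₀ hw.ne', one_mul]

/-- **Window `lintegral`s of NONNEGATIVE observables are static** under the homogeneous Gibbs law:
`∫⁻ ofReal(∫₀ʷ c(Φ_r z) dr) dG = w · ∫⁻ ofReal(c) dG` (Tonelli on the good set + invariance). [folklore] -/
theorem lintegral_window_eq (hσ2 : σ ≤ 1 / 2) (u : V3) (N : ℕ)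
    (Φ : HardSphereFlow (Torus.geometry (Fin 3)) (hsDiameter σ N) (N + 1))
    {c : Config (N + 1) (Fin 3) T3 → ℝ} (hcm : Measurable c) (hc0 : ∀ z, 0 ≤ c z) {w : ℝ} (hw : 0 < w)
    (hci : ∀ z ∈ Φ.good, IntegrableOn (fun r => c (Φ.flow r z)) (Ioc 0 w) volume) :
    ∫⁻ z, ENNReal.ofReal (∫ r in (0 : ℝ)..w, c (Φ.flow r z))
        ∂(localGibbsLaw σ (fun _ => (1 : ℝ)) (fun _ => u) (fun _ => (1 : ℝ)) N Φ) =
      ENNReal.ofReal w * ∫⁻ z, ENNReal.ofReal (c z)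
        ∂(localGibbsLaw σ (fun _ => (1 : ℝ)) (fun _ => u) (fun _ => (1 : ℝ)) N Φ) := by
  set Q := localGibbsLaw σ (fun _ => (1 : ℝ)) (fun _ => u) (fun _ => (1 : ℝ)) N Φ with hQ
  haveI : IsProbabilityMeasure Q := isProbabilityMeasure_localGibbsLaw continuous_const continuous_const
    continuous_const (fun _ => one_pos) (fun _ => one_pos) hσ2 N Φ
  have hgood : Q Φ.goodᶜ = 0 :=
    (withDensity_absolutelyContinuous _ _ : Q ≪ liouville (Torus.geometry (Fin 3)) (N + 1) (hsDiameter σ N))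
      Φ.measure_compl_good
  have hae : ∀ᵐ z ∂Q, z ∈ Φ.good := by
    rw [ae_iff]
    exact hgood
  have h1 : ∀ z ∈ Φ.good, ENNReal.ofReal (∫ r in (0 : ℝ)..w, c (Φ.flow r z)) =
      ∫⁻ r in Ioc 0 w, ENNReal.ofReal (c (Φ.flow r z)) := fun z hz => by
    rw [intervalIntegral.integral_of_le hw.le, ofReal_integral_eq_lintegral_ofReal (hci z hz)
      (ae_of_all _ fun r => hc0 _)]
  calc ∫⁻ z, ENNReal.ofReal (∫ r in (0 : ℝ)..w, c (Φ.flow r z)) ∂Q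
      = ∫⁻ z, (∫⁻ r in Ioc 0 w, ENNReal.ofReal (c (Φ.flow r z))) ∂Q :=
        lintegral_congr_ae (by filter_upwards [hae] with z hz using h1 z hz)
    _ = ∫⁻ r in Ioc 0 w, (∫⁻ z, ENNReal.ofReal (c (Φ.flow r z)) ∂Q) :=
        lintegral_lintegral_swap
          (Φ.aemeasurable_comp_flow_prod_torus hgood (volume.restrict (Ioc 0 w)) (0 : ℝ≥0∞) hcm.ennreal_ofReal)
    _ = ∫⁻ _r in Ioc 0 w, (∫⁻ z, ENNReal.ofReal (c z) ∂Q) := by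
        refine lintegral_congr fun r => ?_
        exact lintegral_comp_flow_localGibbsLaw_const σ 1 1 u N Φ r hcm.ennreal_ofReal
    _ = ENNReal.ofReal w * ∫⁻ z, ENNReal.ofReal (c z) ∂Q := by
        rw [setLIntegral_const, Real.volume_Ioc, sub_zero, mul_comm]

/-- Along a good orbit the cube of the speed of particle `i` is integrable on `(0, w]` (measurable in time, bounded by
energy conservation). [folklore] -/
theorem integrableOn_norm_vel_pow {ε : ℝ} {n : ℕ} (Φ : HardSphereFlow (Torus.geometry (Fin 3)) ε n)
    {z : Config n (Fin 3) T3} (hz : z ∈ Φ.good) (i : Fin n) (m : ℕ) (a b : ℝ) :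
    IntervalIntegrable (fun r => ‖(Φ.flow r z i).2‖ ^ m) volume a b := by
  refine (intervalIntegrable_const (c := Real.sqrt (2 * configEnergy z) ^ m)).mono_fun'
    ((Φ.measurable_vel_orbit hz i).norm.pow_const m).aestronglyMeasurable (ae_of_all _ fun r => ?_)
  show ‖‖(Φ.flow r z i).2‖ ^ m‖ ≤ Real.sqrt (2 * configEnergy z) ^ m
  rw [Real.norm_eq_abs, abs_of_nonneg (by positivity)]
  exact pow_le_pow_left₀ (norm_nonneg _) (Φ.norm_vel_flow_le hz r i) m

/-- **The window cube has static mean `E‖v‖³`** under the homogeneous Gibbs law: integrability and the value of the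
mean of `z ↦ ∫₀ʷ ‖v_i(r)‖³ dr`. [folklore] -/
theorem integrable_windowCube (hσ2 : σ ≤ 1 / 2) (u : V3) (N : ℕ)
    (Φ : HardSphereFlow (Torus.geometry (Fin 3)) (hsDiameter σ N) (N + 1)) (i : Fin (N + 1)) {w : ℝ} (hw : 0 < w) :
    Integrable (fun z => ∫ r in (0 : ℝ)..w, ‖(Φ.flow r z i).2‖ ^ 3)
        (localGibbsLaw σ (fun _ => (1 : ℝ)) (fun _ => u) (fun _ => (1 : ℝ)) N Φ) ∧
      ∫ z, (∫ r in (0 : ℝ)..w, ‖(Φ.flow r z i).2‖ ^ 3)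
          ∂(localGibbsLaw σ (fun _ => (1 : ℝ)) (fun _ => u) (fun _ => (1 : ℝ)) N Φ) =
        w * ∫ v, ‖v‖ ^ 3 ∂gaussMeasure u 1 := by
  set Q := localGibbsLaw σ (fun _ => (1 : ℝ)) (fun _ => u) (fun _ => (1 : ℝ)) N Φ with hQ
  have hgood : Q Φ.goodᶜ = 0 :=
    (withDensity_absolutelyContinuous _ _ : Q ≪ liouville (Torus.geometry (Fin 3)) (N + 1) (hsDiameter σ N))
      Φ.measure_compl_good
  have hcm : Measurable fun z : Config (N + 1) (Fin 3) T3 => ‖(z i).2‖ ^ 3 :=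
    (measurable_pi_apply i).snd.norm.pow_const 3
  have hL := lintegral_window_eq (σ := σ) hσ2 u N Φ hcm (fun z => by positivity) hw
    (fun z hz => (integrableOn_norm_vel_pow Φ hz i 3 0 w).1)
  have hC3 : ∫⁻ z, ENNReal.ofReal (‖(z i).2‖ ^ 3) ∂Q = ENNReal.ofReal (∫ v, ‖v‖ ^ 3 ∂gaussMeasure u 1) := by
    rw [lintegral_vel_localGibbsLaw one_pos one_pos u hσ2 N Φ i (g := fun v => ENNReal.ofReal (‖v‖ ^ 3))
      (measurable_norm.pow_const 3).ennreal_ofReal,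
      ← ofReal_integral_eq_lintegral_ofReal (integrable_norm_pow_gauss u 3) (ae_of_all _ fun v => by positivity)]
  rw [hC3, ← ENNReal.ofReal_mul hw.le] at hL
  have hnn : 0 ≤ᵐ[Q] fun z => ∫ r in (0 : ℝ)..w, ‖(Φ.flow r z i).2‖ ^ 3 :=
    ae_of_all _ fun z => intervalIntegral.integral_nonneg hw.le fun r _ => by positivity
  have hmeas : AEStronglyMeasurable (fun z => ∫ r in (0 : ℝ)..w, ‖(Φ.flow r z i).2‖ ^ 3) Q :=
    (Φ.aemeasurable_intervalIntegral_comp_flow_torus hcm 0 w hgood).aestronglyMeasurable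
  have hint : Integrable (fun z => ∫ r in (0 : ℝ)..w, ‖(Φ.flow r z i).2‖ ^ 3) Q :=
    ⟨hmeas, (hasFiniteIntegral_iff_ofReal hnn).2 (by rw [hL]; exact ENNReal.ofReal_lt_top)⟩
  refine ⟨hint, ?_⟩
  rw [integral_eq_lintegral_of_nonneg_ae hnn hmeas, hL, ENNReal.toReal_ofReal]
  exact mul_nonneg hw.le (integral_nonneg fun v => by positivity)

end WindowExpect


end BandCoherenceLDNegative

end Summit.AtomisticToContinuum.HydrodynamicLimit.Theorems

end
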